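import Literature.Analysis.PDE.SemilinearHeatHolderTools
import Literature.Analysis.PDE.SemilinearHeatMild
import Literature.Analysis.PDE.SemilinearHeatTimeDerivative
import Literature.Analysis.Calculus.JointSmoothnessPartials
import HarnessLib

/-!
# Spatial regularity of mild solutions of semilinear heat systems: the Hölder bootstrap, and
# time-Lipschitz bounds of all spatial derivatives

Analysis/PDE support file (everything proved; no definitions, no named facts). Second step of the
local well-posedness theory of `∂ₜu = Δu + f(x, u, ∂u)` with smooth bounded data on the whole
space (Taylor, *PDE III*, Ch. 15, §1 (local existence by the contraction mapping principle on the integral equation, and the regularity discussion following it);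
Lunardi, *Analytic semigroups …*, §7.1): a mild solution `u` on `(0, T]` with `C¹` slices,
`‖u‖, ‖∂u‖ ≤ R` (`SemilinearHeatMild.lean`) is smooth in space with all derivatives bounded
uniformly in time, by the bootstrap `u(t) ∈ C^{n+1,1/2} ⇒ f(·, u(t), ∂u(t)) ∈ C^{n,1/2}`
(`exists_holder_comp`) `⇒ ∫₀ᵗ e^{(t−s)Δ}f(…) ds ∈ C^{n+2,1/2}` (the level bounds of
`HeatDuhamelSliceLevel.lean`), started at `n = 0` by the `C^{1,1/2}` bound of the Duhamel
integral of bounded data; and every `Dᵏu` is Lipschitz in time on `[0, T]`, uniformly in `x`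
(`Dᵏ` falls on the data; the time-Lipschitz bounds of `ForcedHeatDuhamelTime.lean`), hence
jointly continuous and continuous up to `t = 0`.

* `holder_bootstrap` — `∀ n, ∃ M, ∀ t ∈ (0, T], u(t) ∈ C^{n+1,1/2}` with constant `M`;
* `data_holder_of_slices` — the data `g(t) = f(·, u(t), ∂u(t))` are `C^{n,1/2}` uniformly in
  `t ∈ (0, T]`;
* `contDiff_duhamel_of_isCkBounded` — the Duhamel integral of `Cᵐ`-bounded data is `Cᵐ`;
* `iteratedFDeriv_slice_eq` — `Dᵏu(t) = e^{tΔ}Dᵏu₀ + ∫₀ᵗ e^{(t−s)Δ}Dᵏg̃(s) ds` (`g̃ = 1_{(0,T]}g`);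
* `norm_iteratedFDeriv_slice_sub_le` — `‖Dᵏu(t)(x) − Dᵏu(s)(x)‖ ≤ L|t − s|` on `[0, T]`;
* `continuousOn_iteratedFDeriv_slice` — joint continuity of `(t, x) ↦ Dᵏu(t)(x)` on `[0, T] × E`.

## References

* M. E. Taylor, *Partial Differential Equations III. Nonlinear Equations*, 2nd ed., Springer
  (2011), Ch. 15, §1 (semilinear parabolic equations). [TaylorPDEIII2011]
* A. Lunardi, *Analytic Semigroups and Optimal Regularity in Parabolic Problems*, Birkhäuser
  (1995), §7.1. [folklore]
-/

noncomputable section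

open MeasureTheory Set Function Filter Metric Real
open _root_.Topology
open scoped ENNReal NNReal ContDiff Laplacian

namespace Literature.Analysis.PDE

namespace SemilinearHeat

open Literature.Analysis.UnboundedOperators Literature.Analysis.UnboundedOperators.HeatHolder
open Literature.Analysis.FluidPDE

-- nested operator types
set_option maxSynthPendingDepth 3

section Bootstrap

variable {E : Type} [NormedAddCommGroup E] [InnerProductSpace ℝ E] [FiniteDimensional ℝ E]
  [MeasurableSpace E] [BorelSpace E]
variable {V : Type} [NormedAddCommGroup V] [NormedSpace ℝ V] [CompleteSpace V]

omit [FiniteDimensional ℝ E] [MeasurableSpace E] [BorelSpace E] [CompleteSpace V] in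
/-- Iterated derivatives of `Cⁿ⁺ᵐ`-bounded data are `Cᵐ`-bounded with the same constant. [folklore] -/
theorem isCkBounded_iteratedFDeriv {a : E → V} {A : ℝ} {n m : ℕ} (h : IsCkBounded (n + m) A a) :
    IsCkBounded m A (iteratedFDeriv ℝ n a) := by
  -- `‖Dʲ(Dⁿf)(x)‖ = ‖Dⁿ⁺ʲf(x)‖` (curry isometries; the tree's `FluidPDE.norm_iteratedFDeriv_iteratedFDeriv`,
  -- re-derived here to keep the imports light)
  have hnorm : ∀ {Y : Type} [NormedAddCommGroup Y] [NormedSpace ℝ Y] {f : E → Y} (n j : ℕ) (x : E),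
      ‖iteratedFDeriv ℝ j (iteratedFDeriv ℝ n f) x‖ = ‖iteratedFDeriv ℝ (n + j) f x‖ := by
    intro Y _ _ f n
    induction n generalizing Y with
    | zero =>
      intro j x
      rw [zero_add, iteratedFDeriv_zero_eq_comp]
      exact LinearIsometryEquiv.norm_iteratedFDeriv_comp_left (continuousMultilinearCurryFin0 ℝ E Y).symm f x j
    | succ n ih =>
      intro j x
      have hrep : iteratedFDeriv ℝ (n + 1) f =
          (continuousMultilinearCurryRightEquiv' ℝ n E Y).symm ∘ iteratedFDeriv ℝ n (fun y => fderiv ℝ f y) := by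
        funext y; exact iteratedFDeriv_succ_eq_comp_right
      rw [hrep]
      have h1 := LinearIsometryEquiv.norm_iteratedFDeriv_comp_left (continuousMultilinearCurryRightEquiv' ℝ n E Y).symm
        (iteratedFDeriv ℝ n (fun y => fderiv ℝ f y)) x j
      rw [h1, ih j x, Nat.add_right_comm]
      exact norm_iteratedFDeriv_fderiv
  refine ⟨h.contDiff.iteratedFDeriv_right (by norm_cast; omega), fun j hj x => ?_⟩
  rw [hnorm]
  exact h.norm_le (n + j) (by omega) x

omit [CompleteSpace V] in
/-- **The data along a mild solution.** For `f` continuous with `‖f(x, w)‖ ≤ M₀` on `‖w‖ ≤ R`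
and a family `u` of `C¹` slices with `‖u(t)‖, ‖∂u(t)‖ ≤ R`, `u` and `∂u` jointly measurable,
the data `g(s, y) = f(y, u(s, y), ∂u(s)(y))` form a strongly measurable family of continuous
slices bounded by `M₀`. [folklore] -/
theorem data_basic {f : E × V × (E →L[ℝ] V) → V} (hfc : Continuous f) {R M₀ : ℝ}
    (hM₀ : ∀ (x : E) (w : V × (E →L[ℝ] V)), ‖w‖ ≤ R → ‖f (x, w)‖ ≤ M₀)
    {u : ℝ → E → V} (hu1 : ∀ t, ContDiff ℝ 1 (u t))
    (huR : ∀ t x, ‖u t x‖ ≤ R ∧ ‖fderiv ℝ (u t) x‖ ≤ R)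
    (hum : StronglyMeasurable (uncurry u))
    (hDum : StronglyMeasurable fun p : ℝ × E => fderiv ℝ (u p.1) p.2) :
    StronglyMeasurable (uncurry fun s y => f (y, u s y, fderiv ℝ (u s) y)) ∧
      (∀ s, Continuous fun y => f (y, u s y, fderiv ℝ (u s) y)) ∧
      ∀ s y, ‖f (y, u s y, fderiv ℝ (u s) y)‖ ≤ M₀ := by
  refine ⟨?_, fun s => hfc.comp (continuous_id.prodMk ((hu1 s).continuous.prodMk
    ((hu1 s).continuous_fderiv one_ne_zero))), fun s y => hM₀ y _ ?_⟩
  · have h : StronglyMeasurable fun p : ℝ × E =>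
        ((p.2, (uncurry u p, fderiv ℝ (u p.1) p.2)) : E × V × (E →L[ℝ] V)) :=
      measurable_snd.stronglyMeasurable.prodMk (hum.prodMk hDum)
    exact hfc.comp_stronglyMeasurable h
  · rw [Prod.norm_def]
    exact max_le (huR s y).1 (huR s y).2

omit [FiniteDimensional ℝ E] [MeasurableSpace E] [BorelSpace E] in
/-- **Hölder data from Hölder slices.** If `u(t) ∈ C^{n+1,1/2}` with constant `Mₙ` for
`t ∈ (0, T]`, then `g(t) = f(·, u(t), ∂u(t)) ∈ C^{n,1/2}` with one constant `G` for all
`t ∈ (0, T]` (`exists_holder_comp` applied to the pair field `(u(t), ∂u(t))`, of class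
`C^{n,1/2}` with constant `3Mₙ`). [folklore] -/
theorem data_holder_of_slices {f : E × V × (E →L[ℝ] V) → V} (hf : ContDiff ℝ ∞ f)
    (hB : ∀ (n : ℕ) (R : ℝ), ∃ B, 0 ≤ B ∧ ∀ j ≤ n, ∀ (x : E) (w : V × (E →L[ℝ] V)), ‖w‖ ≤ R →
      ‖iteratedFDeriv ℝ j f (x, w)‖ ≤ B)
    {R : ℝ} {u : ℝ → E → V} (huR : ∀ t x, ‖u t x‖ ≤ R ∧ ‖fderiv ℝ (u t) x‖ ≤ R)
    {T : ℝ} {n : ℕ} {Mn : ℝ} (hM : ∀ t ∈ Ioc 0 T, IsHolderField (n + 1) (1 / 2) Mn (u t)) :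
    ∃ G : ℝ, 0 ≤ G ∧ ∀ t ∈ Ioc 0 T,
      IsHolderField n (1 / 2) G (fun y => f (y, u t y, fderiv ℝ (u t) y)) := by
  obtain ⟨K, hK1, hK⟩ := exists_holder_comp (E := E) n (γ := 1 / 2) (by norm_num) (by norm_num)
  obtain ⟨B, hB0, hBb⟩ := hB (n + 1) R
  refine ⟨K * ((1 + 3 * max Mn 0) * (1 + B)) ^ (2 ^ n), by positivity, fun t ht => ?_⟩
  have hu := hM t ht
  have hMn0 : 0 ≤ Mn := hu.nonneg
  have hmax : 3 * max Mn 0 = 2 * Mn + Mn := by rw [max_eq_left hMn0]; ring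
  have hw : IsHolderField n (1 / 2) (3 * max Mn 0) (fun y => (u t y, fderiv ℝ (u t) y)) := by
    rw [hmax]
    exact isHolderField_prodMk (hu.of_succ (by norm_num) (by norm_num)) hu.fderiv_right
  have hwR : ∀ y, ‖(u t y, fderiv ℝ (u t) y)‖ ≤ R := fun y => by
    rw [Prod.norm_def]; exact max_le (huR t y).1 (huR t y).2
  exact hK (Φ := f) (w := fun y => (u t y, fderiv ℝ (u t) y)) hB0 (hf.of_le (by exact_mod_cast le_top))
    hBb hwR hw

/-- **The Hölder bootstrap.** Let `f` be smooth with all derivatives of order `≤ n` bounded on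
`E × {‖w‖ ≤ R}` for every `n, R`; let `u₀` be smooth with all derivatives bounded; and let `u`
be a mild solution on `(0, T]`, `T ≤ 1`: `C¹` slices with `‖u(t)‖, ‖∂u(t)‖ ≤ R`, `u`, `∂u`
jointly measurable, `u(t) = e^{tΔ}u₀ + ∫₀ᵗ e^{(t−s)Δ}f(·, u(s), ∂u(s)) ds`. Then for every `n`,
`u(t) ∈ C^{n+1,1/2}` with a constant independent of `t ∈ (0, T]`. Base: the free flow of
`u₀ ∈ C^{1,1/2}` and the `C^{1,1/2}` bound of the Duhamel integral of bounded data
(`isHolderField_one_duhamel_of_bound`). Step: `g(t) = f(·, u(t), ∂u(t)) ∈ C^{n,1/2}` uniformly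
(`data_holder_of_slices`), extended by zero off `(0, T]`, gains two derivatives under the Duhamel
integral (`exists_duhamel_level_bounds`). [cite: TaylorPDEIII2011, Ch. 15, §1] -/
theorem holder_bootstrap {f : E × V × (E →L[ℝ] V) → V} (hf : ContDiff ℝ ∞ f)
    (hB : ∀ (n : ℕ) (R : ℝ), ∃ B, 0 ≤ B ∧ ∀ j ≤ n, ∀ (x : E) (w : V × (E →L[ℝ] V)), ‖w‖ ≤ R →
      ‖iteratedFDeriv ℝ j f (x, w)‖ ≤ B)
    {u₀ : E → V} (hu₀ : ∀ n, ∃ A, IsCkBounded n A u₀)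
    {T R : ℝ} (hT1 : T ≤ 1) {u : ℝ → E → V}
    (hu1 : ∀ t, ContDiff ℝ 1 (u t)) (huR : ∀ t x, ‖u t x‖ ≤ R ∧ ‖fderiv ℝ (u t) x‖ ≤ R)
    (hum : StronglyMeasurable (uncurry u))
    (hDum : StronglyMeasurable fun p : ℝ × E => fderiv ℝ (u p.1) p.2)
    (hmild : ∀ t ∈ Ioc 0 T, ∀ x, u t x = heatExtension u₀ t x +
      ∫ s in Ioo 0 t, heatExtension (fun y => f (y, u s y, fderiv ℝ (u s) y)) (t - s) x)
    (n : ℕ) : ∃ M, ∀ t ∈ Ioc 0 T, IsHolderField (n + 1) (1 / 2) M (u t) := by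
  classical
  -- the data
  obtain ⟨M₀, hM₀0, hM₀⟩ := hB 0 R
  have hM₀' : ∀ (x : E) (w : V × (E →L[ℝ] V)), ‖w‖ ≤ R → ‖f (x, w)‖ ≤ M₀ := fun x w hw => by
    have := hM₀ 0 le_rfl x w hw; rwa [norm_iteratedFDeriv_zero] at this
  obtain ⟨hgm, hgc, hgM⟩ := data_basic hf.continuous hM₀' hu1 huR hum hDum
  set c : ℝ := (2 : ℝ) ^ ((Module.finrank ℝ E : ℝ) / 2) with hc
  -- the mild identity as an identity of functions
  have hmildF : ∀ t ∈ Ioc 0 T, u t = heatExtension u₀ t +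
      fun x => ∫ s in Ioo 0 t, heatExtension (fun y => f (y, u s y, fderiv ℝ (u s) y)) (t - s) x :=
    fun t ht => funext fun x => by rw [Pi.add_apply]; exact hmild t ht x
  induction n with
  | zero =>
    obtain ⟨A, hA⟩ := hu₀ 2
    refine ⟨2 * A + 8 * c ^ 2 * M₀ * 1, fun t ht => ?_⟩
    have hfree : IsHolderField 1 (1 / 2) (2 * A) (heatExtension u₀ t) :=
      (hA.isHolderField_of_succ (by norm_num) (by norm_num)).heatExtension ht.1
    have hJ : IsHolderField 1 (1 / 2) (8 * c ^ 2 * M₀ * t ^ (1 / 4 : ℝ))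
        (fun x => ∫ s in Ioo 0 t, heatExtension (fun y => f (y, u s y, fderiv ℝ (u s) y)) (t - s) x) :=
      isHolderField_one_duhamel_of_bound hgm hgc hgM ht.1 (ht.2.trans hT1)
    have ht4 : t ^ (1 / 4 : ℝ) ≤ 1 := Real.rpow_le_one ht.1.le (ht.2.trans hT1) (by norm_num)
    have hJ' := hJ.mono_const (mul_le_mul_of_nonneg_left ht4 (by positivity) :
      8 * c ^ 2 * M₀ * t ^ (1 / 4 : ℝ) ≤ 8 * c ^ 2 * M₀ * 1)
    rw [hmildF t ht]
    exact hfree.add hJ'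
  | succ n ih =>
    obtain ⟨Mn, hMn⟩ := ih
    obtain ⟨G, hG0, hGd⟩ := data_holder_of_slices hf hB huR hMn
    obtain ⟨C, hC0, hlev⟩ := exists_duhamel_level_bounds (E := E) n (γ := 1 / 2) (by norm_num) (by norm_num)
    obtain ⟨A, hA⟩ := hu₀ (n + 3)
    refine ⟨2 * A + C * G, fun t ht => ?_⟩
    -- the data extended by zero off `(0, T]`
    set gt : ℝ → E → V := fun s => if s ∈ Ioc 0 T then (fun y => f (y, u s y, fderiv ℝ (u s) y)) else 0
      with hgt
    have hgt_in : ∀ {s}, s ∈ Ioc 0 T → gt s = fun y => f (y, u s y, fderiv ℝ (u s) y) := fun hs => by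
      simp only [hgt, hs, if_true]
    have hgt_out : ∀ {s}, s ∉ Ioc 0 T → gt s = 0 := fun hs => by simp only [hgt, hs, if_false]
    have hgtH : ∀ s, IsHolderField n (1 / 2) G (gt s) := by
      intro s
      by_cases hs : s ∈ Ioc 0 T
      · rw [hgt_in hs]; exact hGd s hs
      · rw [hgt_out hs]; exact (isHolderField_zero n (1 / 2)).mono_const hG0
    have hgtm : StronglyMeasurable (uncurry gt) := by
      have hfun : uncurry gt = {p : ℝ × E | p.1 ∈ Ioc 0 T}.piecewise
          (uncurry fun s y => f (y, u s y, fderiv ℝ (u s) y)) 0 := by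
        funext p
        by_cases hp : p.1 ∈ Ioc 0 T
        · rw [Set.piecewise_eq_of_mem _ _ _ (show p ∈ {p : ℝ × E | p.1 ∈ Ioc 0 T} from hp)]
          simp only [uncurry, hgt, hp, if_true]
        · rw [Set.piecewise_eq_of_notMem _ _ _ (show p ∉ {p : ℝ × E | p.1 ∈ Ioc 0 T} from hp)]
          simp only [uncurry, hgt, hp, if_false, Pi.zero_apply]
      rw [hfun]
      exact hgm.piecewise (measurable_fst measurableSet_Ioc) stronglyMeasurable_const
    -- the Duhamel integral of `gt` gains two derivatives
    obtain ⟨hJc, hJb, hJH⟩ := hlev (F := V) (g := gt) (M := G) hG0 hgtm (fun s => (hgtH s).contDiff)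
      (fun s k hk y => (hgtH s).norm_le k hk y) (fun s y z => (hgtH s).holder y z) ht.1 (ht.2.trans hT1)
    have hJ : IsHolderField (n + 2) (1 / 2) (C * G)
        (fun x => ∫ s in Ioo 0 t, heatExtension (gt s) (t - s) x) := ⟨hJc, hJb, hJH⟩
    -- and coincides with the Duhamel integral of the data
    have hJeq : (fun x => ∫ s in Ioo 0 t, heatExtension (gt s) (t - s) x) =
        fun x => ∫ s in Ioo 0 t, heatExtension (fun y => f (y, u s y, fderiv ℝ (u s) y)) (t - s) x := by
      funext x
      refine setIntegral_congr_fun measurableSet_Ioo fun s hs => ?_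
      rw [hgt_in ⟨hs.1, hs.2.le.trans ht.2⟩]
    rw [hJeq] at hJ
    have hfree : IsHolderField (n + 2) (1 / 2) (2 * A) (heatExtension u₀ t) :=
      (hA.isHolderField_of_succ (by norm_num) (by norm_num)).heatExtension ht.1
    rw [hmildF t ht]
    exact hfree.add hJ

end Bootstrap

/-! ### All spatial derivatives: representation, time-Lipschitz bounds, joint continuity -/

section TimeRegularity

variable {E : Type} [NormedAddCommGroup E] [InnerProductSpace ℝ E] [FiniteDimensional ℝ E]
  [MeasurableSpace E] [BorelSpace E]
variable {V : Type} [NormedAddCommGroup V] [NormedSpace ℝ V] [CompleteSpace V]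

/-- **The Duhamel integral of `Cᵐ`-bounded data is `Cᵐ`** for `0 < t ≤ 1` (`m = 0`:
continuity by differentiation under the integral; `m = n + 1`: the level bounds at order `n` for
the `C^{n,1/2}` data). [folklore] -/
theorem contDiff_duhamel_of_isCkBounded {gt : ℝ → E → V} {m : ℕ} {G : ℝ}
    (hgtm : StronglyMeasurable (uncurry gt)) (hgt : ∀ s, IsCkBounded m G (gt s))
    {t : ℝ} (ht : 0 < t) (ht1 : t ≤ 1) :
    ContDiff ℝ m (fun x => ∫ s in Ioo 0 t, heatExtension (gt s) (t - s) x) := by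
  rcases Nat.eq_zero_or_pos m with hm | hm
  · subst hm
    exact contDiff_zero.2 (continuous_iff_continuousAt.2 fun x =>
      (hasFDerivAt_duhamel hgtm (fun s => (hgt s).contDiff.continuous)
        (fun s => (hgt s).norm_apply_le) t x).continuousAt)
  · obtain ⟨n, rfl⟩ : ∃ n, m = n + 1 := ⟨m - 1, by omega⟩
    have hG0 : 0 ≤ G := (hgt 0).nonneg
    have hH : ∀ s, IsHolderField n (1 / 2) (2 * G) (gt s) := fun s =>
      (hgt s).isHolderField_of_succ (by norm_num) (by norm_num)
    obtain ⟨C, hC0, hlev⟩ := exists_duhamel_level_bounds (E := E) n (γ := 1 / 2) (by norm_num) (by norm_num)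
    exact ((hlev (F := V) (g := gt) (M := 2 * G) (by positivity) hgtm (fun s => (hH s).contDiff)
      (fun s j hj y => (hH s).norm_le j hj y) (fun s y z => (hH s).holder y z) ht ht1).1).of_le
      (by exact_mod_cast Nat.le_succ _)

/-- **Derivatives fall on the data in the mild representation.** If
`u(t) = e^{tΔ}u₀ + ∫₀ᵗ e^{(t−s)Δ}g̃(s) ds` on `(0, T]` with `u₀` and all slices `g̃(s)` of class
`Cᵏ` with bounded derivatives (one constant for all `s`), then
`Dᵏu(t) = e^{tΔ}Dᵏu₀ + ∫₀ᵗ e^{(t−s)Δ}Dᵏg̃(s) ds`. [folklore] -/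
theorem iteratedFDeriv_slice_eq {u₀ : E → V} {gt : ℝ → E → V} {u : ℝ → E → V} {T : ℝ} {k : ℕ}
    {A G : ℝ} (hT1 : T ≤ 1) (hu₀ : IsCkBounded k A u₀) (hgtm : StronglyMeasurable (uncurry gt))
    (hgt : ∀ s, IsCkBounded k G (gt s))
    (hrep : ∀ t ∈ Ioc 0 T, u t = heatExtension u₀ t +
      fun x => ∫ s in Ioo 0 t, heatExtension (gt s) (t - s) x)
    {t : ℝ} (ht : t ∈ Ioc 0 T) :
    iteratedFDeriv ℝ k (u t) = heatExtension (iteratedFDeriv ℝ k u₀) t +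
      fun x => ∫ s in Ioo 0 t, heatExtension (iteratedFDeriv ℝ k (gt s)) (t - s) x := by
  have hfree := iteratedFDeriv_heatExtension_of_bounded hu₀.contDiff (C := fun _ => A)
    (fun j hj z => hu₀.norm_le j hj z) ht.1 k le_rfl
  have hJ := iteratedFDeriv_duhamel_eq hgtm (n := k) (fun s => (hgt s).contDiff) (Cj := fun _ => G)
    (fun j hj s y => (hgt s).norm_le j hj y) t k le_rfl
  have hfc : ContDiff ℝ k (heatExtension u₀ t) := (hu₀.heatExtension ht.1).contDiff
  have hJc : ContDiff ℝ k (fun x => ∫ s in Ioo 0 t, heatExtension (gt s) (t - s) x) :=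
    contDiff_duhamel_of_isCkBounded hgtm hgt ht.1 (ht.2.trans hT1)
  rw [hrep t ht, iteratedFDeriv_add hfc hJc, hfree, hJ]

/-- **All spatial derivatives are Lipschitz in time on `[0, T]`, uniformly in space.** With
`u(0) = u₀` and the mild representation on `(0, T]`, `T ≤ 1`, data `u₀ ∈ Cᵏ⁺²`,
`g̃(s) ∈ Cᵏ⁺²` bounded: `‖Dᵏu(t)(x) − Dᵏu(s)(x)‖ ≤ L (t − s)` for `0 ≤ s ≤ t ≤ T`
(`Dᵏ` falls on the data; `Dᵏe^{tΔ}h` and `Dᵏ∫₀ᵗe^{(t−τ)Δ}g̃` are Lipschitz in time,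
`ForcedHeatDuhamelTime.lean`; at `s = 0`, `‖e^{tΔ}Dᵏu₀ − Dᵏu₀‖ ≤ dAt` and `‖∫₀ᵗ…‖ ≤ Gt`).
[cite: TaylorPDEIII2011, Ch. 15, §1] -/
theorem norm_iteratedFDeriv_slice_sub_le {u₀ : E → V} {gt : ℝ → E → V} {u : ℝ → E → V} {T : ℝ}
    {k : ℕ} {A G : ℝ} (hT1 : T ≤ 1) (hu₀ : IsCkBounded (k + 2) A u₀)
    (hgtm : StronglyMeasurable (uncurry gt)) (hgt : ∀ s, IsCkBounded (k + 2) G (gt s))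
    (hu0 : u 0 = u₀)
    (hrep : ∀ t ∈ Ioc 0 T, u t = heatExtension u₀ t +
      fun x => ∫ s in Ioo 0 t, heatExtension (gt s) (t - s) x)
    {s t : ℝ} (hs : 0 ≤ s) (hst : s ≤ t) (htT : t ≤ T) (x : E) :
    ‖iteratedFDeriv ℝ k (u t) x - iteratedFDeriv ℝ k (u s) x‖ ≤
      ((Module.finrank ℝ E : ℝ) * A + (1 + (Module.finrank ℝ E : ℝ)) * G) * (t - s) := by
  set d : ℝ := (Module.finrank ℝ E : ℝ) with hd
  have hd0 : 0 ≤ d := by positivity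
  have hA : 0 ≤ A := hu₀.nonneg
  have hG : 0 ≤ G := (hgt 0).nonneg
  -- the representation of `Dᵏu` on `(0, T]`
  have hrepk : ∀ {τ}, τ ∈ Ioc 0 T → iteratedFDeriv ℝ k (u τ) x =
      heatExtension (iteratedFDeriv ℝ k u₀) τ x +
        ∫ r in Ioo 0 τ, heatExtension (iteratedFDeriv ℝ k (gt r)) (τ - r) x := fun hτ => by
    have h := iteratedFDeriv_slice_eq (k := k) hT1 (hu₀.of_le (by omega)) hgtm (fun s => (hgt s).of_le (by omega))
      hrep hτ
    exact congrFun h x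
  -- the Duhamel piece in the library's form
  have hJk : ∀ {τ}, τ ∈ Ioc 0 T → (∫ r in Ioo 0 τ, heatExtension (iteratedFDeriv ℝ k (gt r)) (τ - r) x) =
      iteratedFDeriv ℝ k (heatDuhamel 0 gt τ) x := by
    intro τ hτ
    have h := iteratedFDeriv_duhamel_eq hgtm (n := k) (fun s => ((hgt s).of_le (by omega : k ≤ k + 2)).contDiff)
      (Cj := fun _ => G) (fun j hj s y => (hgt s).norm_le j (by omega) y) τ k le_rfl
    exact (congrFun h x).symm
  rcases hs.eq_or_lt with rfl | hs0
  · -- `s = 0`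
    rcases hst.eq_or_lt with rfl | ht0
    · simp
    have ht : t ∈ Ioc 0 T := ⟨ht0, htT⟩
    rw [hu0, hrepk ht]
    calc ‖heatExtension (iteratedFDeriv ℝ k u₀) t x +
          (∫ r in Ioo 0 t, heatExtension (iteratedFDeriv ℝ k (gt r)) (t - r) x) - iteratedFDeriv ℝ k u₀ x‖
        = ‖(heatExtension (iteratedFDeriv ℝ k u₀) t x - iteratedFDeriv ℝ k u₀ x) +
            ∫ r in Ioo 0 t, heatExtension (iteratedFDeriv ℝ k (gt r)) (t - r) x‖ := by abel_nf
      _ ≤ ‖heatExtension (iteratedFDeriv ℝ k u₀) t x - iteratedFDeriv ℝ k u₀ x‖ +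
            ‖∫ r in Ioo 0 t, heatExtension (iteratedFDeriv ℝ k (gt r)) (t - r) x‖ := norm_add_le _ _
      _ ≤ d * A * t + G * t := by
          refine add_le_add ?_ (norm_duhamel_le (fun r y => (hgt r).norm_le k (by omega) y) ht0.le x)
          have h := norm_iteratedFDeriv_heatExtension_sub_self_le hu₀ ht0 x
          rwa [iteratedFDeriv_heatExtension_of_bounded ((hu₀.of_le (by omega : k ≤ k + 2)).contDiff)
            (C := fun _ => A) (fun j hj z => hu₀.norm_le j (by omega) z) ht0 k le_rfl] at h
      _ ≤ (d * A + (1 + d) * G) * (t - 0) := by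
          have : 0 ≤ d * G * t := by positivity
          nlinarith
  · -- `0 < s ≤ t`
    have hsI : s ∈ Ioc 0 T := ⟨hs0, hst.trans htT⟩
    have htI : t ∈ Ioc 0 T := ⟨hs0.trans_le hst, htT⟩
    rw [hrepk htI, hrepk hsI, hJk htI, hJk hsI]
    calc ‖heatExtension (iteratedFDeriv ℝ k u₀) t x + iteratedFDeriv ℝ k (heatDuhamel 0 gt t) x -
          (heatExtension (iteratedFDeriv ℝ k u₀) s x + iteratedFDeriv ℝ k (heatDuhamel 0 gt s) x)‖
        = ‖(heatExtension (iteratedFDeriv ℝ k u₀) t x - heatExtension (iteratedFDeriv ℝ k u₀) s x) +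
            (iteratedFDeriv ℝ k (heatDuhamel 0 gt t) x - iteratedFDeriv ℝ k (heatDuhamel 0 gt s) x)‖ := by
          abel_nf
      _ ≤ ‖heatExtension (iteratedFDeriv ℝ k u₀) t x - heatExtension (iteratedFDeriv ℝ k u₀) s x‖ +
            ‖iteratedFDeriv ℝ k (heatDuhamel 0 gt t) x - iteratedFDeriv ℝ k (heatDuhamel 0 gt s) x‖ :=
          norm_add_le _ _
      _ ≤ d * A * (t - s) + (1 + d) * G * (t - s) := by
          refine add_le_add ?_ ?_
          · have h := norm_iteratedFDeriv_heatExtension_sub_heatExtension_le hu₀ hs0 hst x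
            rwa [iteratedFDeriv_heatExtension_of_bounded ((hu₀.of_le (by omega : k ≤ k + 2)).contDiff)
              (C := fun _ => A) (fun j hj z => hu₀.norm_le j (by omega) z) (hs0.trans_le hst) k le_rfl,
              iteratedFDeriv_heatExtension_of_bounded ((hu₀.of_le (by omega : k ≤ k + 2)).contDiff)
              (C := fun _ => A) (fun j hj z => hu₀.norm_le j (by omega) z) hs0 k le_rfl] at h
          · exact norm_iteratedFDeriv_heatDuhamel_sub_le hgtm (fun τ hτ => hgt τ) hG hT1 hs0.le hst htT x
      _ = (d * A + (1 + d) * G) * (t - s) := by ring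

omit [FiniteDimensional ℝ E] [MeasurableSpace E] [BorelSpace E] [CompleteSpace V] in
/-- **Joint continuity of all spatial derivatives on `[0, T] × E`** (Lipschitz in time
uniformly in space, continuous in space). [folklore] -/
theorem continuousOn_iteratedFDeriv_slice {u : ℝ → E → V} {T : ℝ} {k : ℕ} {L : ℝ}
    (hsmooth : ∀ t ∈ Icc 0 T, ContDiff ℝ k (u t))
    (hlip : ∀ s t, 0 ≤ s → s ≤ t → t ≤ T → ∀ x,
      ‖iteratedFDeriv ℝ k (u t) x - iteratedFDeriv ℝ k (u s) x‖ ≤ L * (t - s)) :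
    ContinuousOn (fun p : ℝ × E => iteratedFDeriv ℝ k (u p.1) p.2) (Icc 0 T ×ˢ univ) := by
  have hsym : ∀ s ∈ Icc 0 T, ∀ t ∈ Icc 0 T, ∀ x,
      ‖iteratedFDeriv ℝ k (u t) x - iteratedFDeriv ℝ k (u s) x‖ ≤ |L| * |t - s| := by
    intro s hs t ht x
    rcases le_total s t with hst | hts
    · calc _ ≤ L * (t - s) := hlip s t hs.1 hst ht.2 x
        _ ≤ |L| * |t - s| := by
            rw [abs_of_nonneg (sub_nonneg.2 hst)]
            exact mul_le_mul_of_nonneg_right (le_abs_self L) (sub_nonneg.2 hst)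
    · rw [← norm_neg, neg_sub]
      calc _ ≤ L * (s - t) := hlip t s ht.1 hts hs.2 x
        _ ≤ |L| * |t - s| := by
            rw [abs_sub_comm, abs_of_nonneg (sub_nonneg.2 hts)]
            exact mul_le_mul_of_nonneg_right (le_abs_self L) (sub_nonneg.2 hts)
  refine Calculus.continuousOn_prod_of_locally_uniform
    (fun t ht => (hsmooth t ht).continuous_iteratedFDeriv le_rfl) fun t₀ ht₀ ε hε => ?_
  have hδ : 0 < ε / (|L| + 1) := by positivity
  filter_upwards [inter_mem_nhdsWithin (Icc 0 T) (ball_mem_nhds t₀ hδ)] with t ht y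
  rw [dist_eq_norm]
  calc ‖iteratedFDeriv ℝ k (u t) y - iteratedFDeriv ℝ k (u t₀) y‖ ≤ |L| * |t - t₀| := hsym t₀ ht₀ t ht.1 y
    _ ≤ |L| * (ε / (|L| + 1)) := by
        gcongr
        have h := mem_ball.1 ht.2
        rw [Real.dist_eq] at h
        exact h.le
    _ ≤ ε := by
        rw [mul_div_assoc']
        rw [div_le_iff₀ (by positivity)]
        nlinarith [abs_nonneg L]

end TimeRegularity

end SemilinearHeat

end Literature.Analysis.PDE
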